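import Summits.QuantumFields.YangMills.Theorems.BalabanUVNodesN11TopPairDescendantsDead

/-!
EDITION v1.1 (dag-n11-d g31, 2026-08-29; T0′ of the FLAG №1 R2b cure): the proviso-keyed theorems take the DISPLAYED one-scale law `hzh` of the step-1 residuals (K1-face
theorem: as an extra hypothesis inside the run-indexed chain) instead of reading it off the row `zhLocal`, which the cure re-types IN PLACE to print's two-scale law; content unchanged.

# DAG node N11 — THE MAIN TERM AT EVERY PARAMETER WHOSE STEP-1 RESIDUAL IS ONE-SCALE (`hzh`, displayed), READ ON THE DENSITIES THEMSELVES: at every `θ : Stage13HParams F 2` obeying `hzh` (NOT implied by K1⁹'s provisos since W2∕T1′) with [B16] Thm 1's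
# `Sect2Form 1`, every effective density of record `ρ_k`, `1 ≤ k ≤ K`, equals `dV`-a.e. its (2.18) sum RESTRICTED to the histories that were NOT all-small at the first step —
# `ρ_k = Σ_{s : (Ω₁,Λ₁)(s) ≠ (𝕋,𝕋)} χ_k(s)·slot_k(s)` a.e.; read straight off K1⁹'s (B) face + `hzh` along Theorem 1's runs (count-neutral, LOCATED)

HEADER — WORK-UNIT METADATA.  Cell `pub-ymgap`, YM-PLAN Track A (HUMAN RULING D-0062), seat `pub-ymgap-dag-n11-d` (g19; N11 [B14], s2), route `BalabanUVNodes`, item K1⁹ =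
stmt-QuantumFields-27364 (helper lane, `--kind proof --supports 27364 --as helper`, count-neutral).  [III] = [Balaban1988Convergent], [IV] = [Balaban1989LargeFieldI], [B16] =
[Balaban1989LargeFieldII].  Over this seat's g19 `…N11TopPairDescendantsDead` (★★★★★★ `descendants_dead_of_sLaw_one_su2`), node00-def-T's RECORD 13 (`densOfRecord₁₃` = `rhoOfRecord9` =
`densityOfRepr` of the post-𝐑 slot family: `ρ_k(V) = Σ_s χ_k(s)(V)·slot_k(s)(V)`, (2.18) by construction), RECORD 13 v1.7 `H` ∕ v1.8 `V` (`SLaw₁₃CoPH`, `sect2Form_stage13SepCoPH_iff`,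
`datumOfRecord₁₃SepCoPHV`, the revised tower's `v.ρ`), `B16.EndStatementBPrinted`.

WHY THIS FILE.  `…DescendantsDead` kills, at every `θ` obeying the displayed one-scale law `hzh` with `SLaw₁₃CoPH θ p 1`, the piece `χ_k(s)·slot_k(s)` of EVERY history `s` of length `k ≤ K` with `Ω₁(s) = Λ₁(s) = 𝕋`, `dV`-a.e.
The density of record IS the finite (2.18) sum of those pieces (`densOfRecord₁₃ … k V = Σ_s χ_k(s)(V)·slot_k(s)(V)`, definitional), and a finite sum of a.e.-zero terms is a.e. zero — so
`ρ_k` equals a.e. the sum over the complementary histories.  That is the literal reading of «the main term is absent»: along the runs of [B16] Theorem 1 at every K1⁹ witness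
`(θ, h, v)` at `SU(2)` meeting the guards, NO effective density after the first step is built from the configurations that were small there (the revised densities `v.ρ` of the
version slot are a.e.-versions of `ρ_k`, so the same holds for them — §2).

WHAT THIS FILE PROVES (0 `def`, 0 `sorry`, standard axioms).  §1 `densOfRecord₁₃_apply` (definitional unfolding) · ★★★ `densityOfSlice_ae_eq_sum_filter_of_pieces_ae_zero` (generic: the
pieces of a finite family of histories vanish a.e. ⇒ the assembled density equals a.e. the sum over the rest) · ★★★★★★ `densOfRecord₁₃_ae_eq_sum_not_allSmallAtOne_of_sLaw_one_su2` · ★★★★★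
`tdensOfRecord₁₃_ae_eq_sum_not_allSmallAtOne_of_sLaw_one_su2` (`𝐓ρ_k` too, `1 ≤ k < K`).  §2
★★★★★★ `densOfRecord₁₃_ae_eq_sum_not_allSmallAtOne_of_endStatementBPrinted_su2` (K1⁹'s (B) conjunct + `hzh` ⇒ `∃ γ > 0`, along every run in the window with `1 ≤ K` and the guards, every `ρ_k`,
`1 ≤ k ≤ K`, is a.e. the restricted sum).

HONEST FRAMING.  A NECESSARY-CONDITION reading on the tree's own rows and objects (count-neutral, LOCATED; repair census in `…N11TopPairLocalResidual`'s header); nothing of Bałaban asserted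
or refuted; K1⁹ NOT refuted (the complementary histories may carry every `ρ_k`, and [III] Cor. 3's lower bound at an all-small `V` reads histories whose TOP label is all-small, not only
the descendants of the top pair); N11 NOT discharged; K1⁹ NOT closed; no registered stub touched; counts unmoved (typed 28∕28 · discharged 6∕27 · A 6∕28); NOT ℝ⁴ ∕ OS ∕ mass gap ∕ Clay.
No `sorry`, `axiom`, `def`, `instance`, `notation`.  Sources (SHAPE only): [III] Thm 1 p.262, (2.1) p.254, (2.17)–(2.18) p.257, (3.24)–(3.25) p.270, Cor. 3 (2.50) p.264; [IV] (0.3) p.176;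
[B16] Thm 1 p.355.
-/

noncomputable section

open MeasureTheory
open scoped BigOperators Matrix.Norms.L2Operator

namespace Summit.QuantumFields.YangMills.Theorems.BalabanUVNodesN11DensityWithoutAllSmallTerm

open Literature.MathematicalPhysics.QuantumFieldTheory.Balaban1983to89 T4Continuum Node00 Node00.Tk B14.Eq218Concrete B14.Sect3Decomp
open Literature.MathematicalPhysics.QuantumFieldTheory.Balaban1983to89.ExpMeanLog (deltaSU)
open B14.Eq213MaximalDomains (side)
open BalabanUVNodesN11TopPairDescendantsDead (descendants_dead_of_sLaw_one_su2 descendants_slotsT_dead_of_sLaw_one_su2)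

variable {F : T4Family} {N : ℕ} [NeZero N]

/-! ## §1. The density of record is the (2.18) sum of the pieces; dropping a.e.-dead pieces -/

section Generic

variable (ν : Stage7Numerics) (τ : TowerNumerics) (p : B12.RunParams) (g : ℕ → ℝ)

/-- **A FINITE FAMILY OF a.e.-DEAD PIECES DROPS OUT OF THE ASSEMBLED DENSITY**: if `χ_k(s)·f(s) = 0` `dV`-a.e. for every history `s` with `P s`, then
`Σ_s χ_k(s)·f(s) = Σ_{s : ¬P s} χ_k(s)·f(s)` `dV`-a.e. (finitely many null sets). [cite: Balaban1988Convergent, (2.17)–(2.18) p.257 (bookkeeping)] -/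
theorem densityOfSlice_ae_eq_sum_filter_of_pieces_ae_zero {k : ℕ} (f : TexpASlot F N ν τ.M p g k) (P : SeqOfRecord F ν τ.M g p.K k → Prop) [DecidablePred P]
    (h : ∀ s, P s → ∀ᵐ V ∂fieldMeasure (F.P p.K) k (SU N), chiSeqOfRecord F N ν τ.M g p.K k s V * f s V = 0) :
    densityOfSlice F N ν τ.M p g k f =ᵐ[fieldMeasure (F.P p.K) k (SU N)]
      fun V => ∑ s ∈ Finset.univ.filter (fun s => ¬ P s), chiSeqOfRecord F N ν τ.M g p.K k s V * f s V := by
  have hall : ∀ᵐ V ∂fieldMeasure (F.P p.K) k (SU N), ∀ s, P s → chiSeqOfRecord F N ν τ.M g p.K k s V * f s V = 0 := by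
    rw [ae_all_iff]
    intro s
    by_cases hs : P s
    · exact (h s hs).mono fun V hV _ => hV
    · exact Filter.Eventually.of_forall fun V hs' => absurd hs' hs
  filter_upwards [hall] with V hV
  show (∑ s : SeqOfRecord F ν τ.M g p.K k, chiSeqOfRecord F N ν τ.M g p.K k s V * f s V) = _
  rw [← Finset.sum_filter_add_sum_filter_not Finset.univ P]
  rw [Finset.sum_eq_zero fun s hs => hV s (Finset.mem_filter.1 hs).2, zero_add]

end Generic

section Record

variable {F : T4Family} (θ : Stage13HParams F 2) (p : B12.RunParams)

/-- **THE DENSITY OF RECORD, UNFOLDED** (definitional): `ρ_k(V) = Σ_s χ_k(s)(V)·slot_k(s)(V)` over the histories of length `k` — (2.18) by construction.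
[cite: Balaban1988Convergent, (2.18) p.257 (bookkeeping)] -/
theorem densOfRecord₁₃_apply (k : ℕ) (V : GaugeField (F.P p.K) k (SU 2)) :
    densOfRecord₁₃ F 2 θ.toStage13Params p k V =
      ∑ s : SeqOfRecord F θ.ν θ.τ9.M (gOfRecord₁₃ F 2 θ.toStage13Params p) p.K k,
        chiSeqOfRecord F 2 θ.ν θ.τ9.M (gOfRecord₁₃ F 2 θ.toStage13Params p) p.K k s V *
          slotsOfRecord F 2 θ.ν θ.τ9 (EOfRecord₁₃ F 2 θ.toStage13Params) (wOfRecord₉ F 2 θ.toStage9Params) θ.ppSel p (gOfRecord₁₃ F 2 θ.toStage13Params p) k s V := rfl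

/-- The density of record IS the slice density of the post-𝐑 slot family (definitional). [cite: Balaban1988Convergent, (2.18) p.257 (bookkeeping)] -/
theorem densOfRecord₁₃_eq_densityOfSlice (k : ℕ) :
    densOfRecord₁₃ F 2 θ.toStage13Params p k =
      densityOfSlice F 2 θ.ν θ.τ9.M p (gOfRecord₁₃ F 2 θ.toStage13Params p) k
        (slotsOfRecord F 2 θ.ν θ.τ9 (EOfRecord₁₃ F 2 θ.toStage13Params) (wOfRecord₉ F 2 θ.toStage9Params) θ.ppSel p (gOfRecord₁₃ F 2 θ.toStage13Params p) k) := rfl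

open Classical in
/-- (v1.1, T0′ of the FLAG №1 R2b cure: the DISPLAYED one-scale law `hzh` of the step-1 residuals replaces the proviso structure, whose row `zhLocal` the cure re-types to print's two-scale law.) ★★★★★★ **`ρ_k` IS a.e. THE (2.18) SUM OVER THE HISTORIES THAT WERE NOT ALL-SMALL AT THE FIRST STEP** — at every `θ : Stage13HParams F 2` whose step-1 residuals obey `hzh` (no proviso read; name kept), under the
numerics guards, `SLaw₁₃CoPH θ p 1` ⇒ for `1 ≤ k ≤ K`: `ρ_k =ᵐ Σ_{s : ¬(Ω₁(s) = 𝕋 ∧ Λ₁(s) = 𝕋)} χ_k(s)·slot_k(s)`.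
[cite: Balaban1988Convergent, Thm 1 p.262, (2.1) p.254, (2.17)–(2.18) p.257, (3.1)–(3.5) pp.264–265, (3.24)–(3.25) p.270, p.267; Balaban1989LargeFieldI, (0.3) p.176; Balaban1985Averaging, Prop. 2 (52)–(54) p.26] -/
theorem densOfRecord₁₃_ae_eq_sum_not_allSmallAtOne_of_sLaw_one_su2 (hzh : ∀ (Ω Λ : ℕ → Set (Site (F.P p.K) 0)) Y ω ω', ω 0 = ω' 0 → (θ.Zh p 1 Ω Λ).ζ0 0 Y ω = (θ.Zh p 1 Ω Λ).ζ0 0 Y ω') (hM : 1 ≤ θ.τ9.M) (hM₂ : 0 < θ.ν.M₂) (hK : 0 < p.K) {α₀ : ℝ} (hα : 0 < α₀)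
    (hα3 : (143 * (((((F.P p.K).d + 4 : ℕ) : ℝ)) ^ 2 / 4) ^ 2) * α₀ ≤ 1 / 3)
    (hα2 : 2 * α₀ ≤ 2 * deltaSU (Fin 2) / ((((F.P p.K).d + 4) * (F.P p.K).L : ℕ) : ℝ) ^ 2)
    (hαε : epsOfRecord θ.ν (gOfRecord₁₃ F 2 θ.toStage13Params p) 1 * (F.P p.K).eta 1 ^ 2 + 4 * (2 * deltaOfRecord θ.ν (gOfRecord₁₃ F 2 θ.toStage13Params p) 0 θ.A₁) ≤
      α₀ * (F.P p.K).eta 1 ^ 2)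
    (hαr : 2 * α₀ * (((F.P p.K).L : ℝ) ^ 1 * (F.P p.K).eta 1) ^ 2 ≤ 2 * θ.ν.εreg)
    (hε₁ : 0 < epsOfRecord θ.ν (gOfRecord₁₃ F 2 θ.toStage13Params p) 1 * (F.P p.K).eta 1 ^ 2) (hmK : 1 ≤ (F.P p.K).m + (F.P p.K).K) (hε : 0 < θ.ν.εreg)
    (hε3 : (143 * (((((F.P p.K).d + 4 : ℕ) : ℝ)) ^ 2 / 4) ^ 2) * θ.ν.εreg ≤ 1 / 3)
    (hε2 : 2 * θ.ν.εreg ≤ 2 * deltaSU (Fin 2) / ((((F.P p.K).d + 4) * (F.P p.K).L : ℕ) : ℝ) ^ 2)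
    (hM1 : 1 ≤ θ.ν.M₁) (h3 : 3 * side (F.P p.K).L θ.ν.M₁ 1 ≤ sideχ F θ.ν p (gOfRecord₁₃ F 2 θ.toStage13Params p) 0)
    (hSL : SLaw₁₃CoPH F 2 θ p 1) {k : ℕ} (hk1 : 1 ≤ k) (hkK : k ≤ p.K) :
    densOfRecord₁₃ F 2 θ.toStage13Params p k =ᵐ[fieldMeasure (F.P p.K) k (SU 2)]
      fun V => ∑ s ∈ Finset.univ.filter (fun s : SeqOfRecord F θ.ν θ.τ9.M (gOfRecord₁₃ F 2 θ.toStage13Params p) p.K k => ¬ (s.Ω 1 = Set.univ ∧ s.Λ 1 = Set.univ)),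
        chiSeqOfRecord F 2 θ.ν θ.τ9.M (gOfRecord₁₃ F 2 θ.toStage13Params p) p.K k s V *
          slotsOfRecord F 2 θ.ν θ.τ9 (EOfRecord₁₃ F 2 θ.toStage13Params) (wOfRecord₉ F 2 θ.toStage9Params) θ.ppSel p (gOfRecord₁₃ F 2 θ.toStage13Params p) k s V := by
  rw [densOfRecord₁₃_eq_densityOfSlice]
  exact densityOfSlice_ae_eq_sum_filter_of_pieces_ae_zero θ.ν θ.τ9 p (gOfRecord₁₃ F 2 θ.toStage13Params p) _ (fun s => s.Ω 1 = Set.univ ∧ s.Λ 1 = Set.univ)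
    (fun s hs => descendants_dead_of_sLaw_one_su2 θ p hzh hM hM₂ hK hα hα3 hα2 hαε hαr hε₁ hmK hε hε3 hε2 hM1 h3 hSL hk1 hkK s hs.1 hs.2)

/-- The 𝐓-stepped density of record IS the slice density of the PRE-𝐑 slot family at level `k+1` (definitional). [cite: Balaban1988Convergent, (3.1) p.264, (3.25) p.270 (bookkeeping)] -/
theorem tdensOfRecord₁₃_eq_densityOfSlice (k : ℕ) :
    tdensOfRecord₁₃ F 2 θ.toStage13Params p k =
      densityOfSlice F 2 θ.ν θ.τ9.M p (gOfRecord₁₃ F 2 θ.toStage13Params p) (k + 1)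
        (slotsTOfRecord F 2 θ.ν θ.τ9 (EOfRecord₁₃ F 2 θ.toStage13Params) (wOfRecord₉ F 2 θ.toStage9Params) θ.ppSel p (gOfRecord₁₃ F 2 θ.toStage13Params p) (k + 1)) := rfl

open Classical in
/-- (v1.1, T0′ of the FLAG №1 R2b cure: the DISPLAYED one-scale law `hzh` of the step-1 residuals replaces the proviso structure, whose row `zhLocal` the cure re-types to print's two-scale law.) ★★★★★ **`𝐓ρ_k` TOO IS a.e. THE (3.25) SUM OVER THE HISTORIES THAT WERE NOT ALL-SMALL AT THE FIRST STEP** (`1 ≤ k < K`): the children of the dead sub-tower have 𝐓-slots vanishing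
a.e. (`…DescendantsDead.descendants_slotsT_dead_of_sLaw_one_su2`), so the next 𝐓-laws' identity clauses along that sub-tower are all vacuous.
[cite: Balaban1988Convergent, Thm 1 p.262, (3.1) p.264, (3.24)–(3.25) p.270; Balaban1989LargeFieldI, (0.3) p.176; Balaban1985Averaging, Prop. 2 (52)–(54) p.26] -/
theorem tdensOfRecord₁₃_ae_eq_sum_not_allSmallAtOne_of_sLaw_one_su2 (hzh : ∀ (Ω Λ : ℕ → Set (Site (F.P p.K) 0)) Y ω ω', ω 0 = ω' 0 → (θ.Zh p 1 Ω Λ).ζ0 0 Y ω = (θ.Zh p 1 Ω Λ).ζ0 0 Y ω') (hM : 1 ≤ θ.τ9.M) (hM₂ : 0 < θ.ν.M₂) (hK : 0 < p.K) {α₀ : ℝ} (hα : 0 < α₀)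
    (hα3 : (143 * (((((F.P p.K).d + 4 : ℕ) : ℝ)) ^ 2 / 4) ^ 2) * α₀ ≤ 1 / 3)
    (hα2 : 2 * α₀ ≤ 2 * deltaSU (Fin 2) / ((((F.P p.K).d + 4) * (F.P p.K).L : ℕ) : ℝ) ^ 2)
    (hαε : epsOfRecord θ.ν (gOfRecord₁₃ F 2 θ.toStage13Params p) 1 * (F.P p.K).eta 1 ^ 2 + 4 * (2 * deltaOfRecord θ.ν (gOfRecord₁₃ F 2 θ.toStage13Params p) 0 θ.A₁) ≤
      α₀ * (F.P p.K).eta 1 ^ 2)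
    (hαr : 2 * α₀ * (((F.P p.K).L : ℝ) ^ 1 * (F.P p.K).eta 1) ^ 2 ≤ 2 * θ.ν.εreg)
    (hε₁ : 0 < epsOfRecord θ.ν (gOfRecord₁₃ F 2 θ.toStage13Params p) 1 * (F.P p.K).eta 1 ^ 2) (hmK : 1 ≤ (F.P p.K).m + (F.P p.K).K) (hε : 0 < θ.ν.εreg)
    (hε3 : (143 * (((((F.P p.K).d + 4 : ℕ) : ℝ)) ^ 2 / 4) ^ 2) * θ.ν.εreg ≤ 1 / 3)
    (hε2 : 2 * θ.ν.εreg ≤ 2 * deltaSU (Fin 2) / ((((F.P p.K).d + 4) * (F.P p.K).L : ℕ) : ℝ) ^ 2)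
    (hM1 : 1 ≤ θ.ν.M₁) (h3 : 3 * side (F.P p.K).L θ.ν.M₁ 1 ≤ sideχ F θ.ν p (gOfRecord₁₃ F 2 θ.toStage13Params p) 0)
    (hSL : SLaw₁₃CoPH F 2 θ p 1) {k : ℕ} (hk1 : 1 ≤ k) (hkK : k < p.K) :
    tdensOfRecord₁₃ F 2 θ.toStage13Params p k =ᵐ[fieldMeasure (F.P p.K) (k + 1) (SU 2)]
      fun V => ∑ s ∈ Finset.univ.filter (fun s : SeqOfRecord F θ.ν θ.τ9.M (gOfRecord₁₃ F 2 θ.toStage13Params p) p.K (k + 1) => ¬ (s.Ω 1 = Set.univ ∧ s.Λ 1 = Set.univ)),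
        chiSeqOfRecord F 2 θ.ν θ.τ9.M (gOfRecord₁₃ F 2 θ.toStage13Params p) p.K (k + 1) s V *
          slotsTOfRecord F 2 θ.ν θ.τ9 (EOfRecord₁₃ F 2 θ.toStage13Params) (wOfRecord₉ F 2 θ.toStage9Params) θ.ppSel p (gOfRecord₁₃ F 2 θ.toStage13Params p) (k + 1) s V := by
  rw [tdensOfRecord₁₃_eq_densityOfSlice]
  refine densityOfSlice_ae_eq_sum_filter_of_pieces_ae_zero θ.ν θ.τ9 p (gOfRecord₁₃ F 2 θ.toStage13Params p) _ (fun s => s.Ω 1 = Set.univ ∧ s.Λ 1 = Set.univ)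
    (fun s hs => ?_)
  filter_upwards [descendants_slotsT_dead_of_sLaw_one_su2 θ p hzh hM hM₂ hK hα hα3 hα2 hαε hαr hε₁ hmK hε hε3 hε2 hM1 h3 hSL hk1 hkK s hs.1 hs.2] with V hV
  rw [hV, mul_zero]

end Record

/-! ## §2. Read off K1⁹'s own (B) face -/

section K1Face

variable {F : T4Family} (θ : Stage13HParams F 2) (h : θ.Provisos₁₃SepCoPH F 2) (v : Revision₁₃ F 2 θ h)

open Classical in
/-- ★★★★★★ **K1⁹'s (B) CONJUNCT ⇒ ALONG EVERY RUN IN THEOREM 1's WINDOW WITH `1 ≤ K` (guards at the run), EVERY `ρ_k` (`1 ≤ k ≤ K`) IS a.e. THE SUM OVER THE HISTORIES NOT ALL-SMALL AT THE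
FIRST STEP.** [cite: Balaban1989LargeFieldII, Thm 1 p.355; Balaban1988Convergent, Thm 1 p.262, (2.18) p.257, (3.24)–(3.25) p.270; Balaban1989LargeFieldI, (0.3) p.176; Balaban1985Averaging, Prop. 2 (52)–(54) p.26] **(v1.1, T0′ of the FLAG №1 R2b cure: plus the DISPLAYED one-scale law of the step-1 residuals inside the run-indexed chain.)** -/
theorem densOfRecord₁₃_ae_eq_sum_not_allSmallAtOne_of_endStatementBPrinted_su2 (hB : B16.EndStatementBPrinted (datumOfRecord₁₃SepCoPHV F 2 θ h v).C) :
    ∃ γ : ℝ, 0 < γ ∧ ∀ p : B12.RunParams, ((datumOfRecord₁₃SepCoPHV F 2 θ h v).C p).flow.InInterval γ p.K → 1 ≤ p.K →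
      1 ≤ θ.τ9.M → 0 < θ.ν.M₂ → ∀ {α₀ : ℝ}, 0 < α₀ →
      (143 * (((((F.P p.K).d + 4 : ℕ) : ℝ)) ^ 2 / 4) ^ 2) * α₀ ≤ 1 / 3 →
      2 * α₀ ≤ 2 * deltaSU (Fin 2) / ((((F.P p.K).d + 4) * (F.P p.K).L : ℕ) : ℝ) ^ 2 →
      epsOfRecord θ.ν (gOfRecord₁₃ F 2 θ.toStage13Params p) 1 * (F.P p.K).eta 1 ^ 2 + 4 * (2 * deltaOfRecord θ.ν (gOfRecord₁₃ F 2 θ.toStage13Params p) 0 θ.A₁) ≤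
        α₀ * (F.P p.K).eta 1 ^ 2 →
      2 * α₀ * (((F.P p.K).L : ℝ) ^ 1 * (F.P p.K).eta 1) ^ 2 ≤ 2 * θ.ν.εreg →
      0 < epsOfRecord θ.ν (gOfRecord₁₃ F 2 θ.toStage13Params p) 1 * (F.P p.K).eta 1 ^ 2 → 1 ≤ (F.P p.K).m + (F.P p.K).K → 0 < θ.ν.εreg →
      (143 * (((((F.P p.K).d + 4 : ℕ) : ℝ)) ^ 2 / 4) ^ 2) * θ.ν.εreg ≤ 1 / 3 →
      2 * θ.ν.εreg ≤ 2 * deltaSU (Fin 2) / ((((F.P p.K).d + 4) * (F.P p.K).L : ℕ) : ℝ) ^ 2 →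
      1 ≤ θ.ν.M₁ → 3 * side (F.P p.K).L θ.ν.M₁ 1 ≤ sideχ F θ.ν p (gOfRecord₁₃ F 2 θ.toStage13Params p) 0 →
      (∀ (Ω Λ : ℕ → Set (Site (F.P p.K) 0)) Y ω ω', ω 0 = ω' 0 → (θ.Zh p 1 Ω Λ).ζ0 0 Y ω = (θ.Zh p 1 Ω Λ).ζ0 0 Y ω') →
      ∀ {k : ℕ}, 1 ≤ k → k ≤ p.K →
        densOfRecord₁₃ F 2 θ.toStage13Params p k =ᵐ[fieldMeasure (F.P p.K) k (SU 2)]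
          fun V => ∑ s ∈ Finset.univ.filter (fun s : SeqOfRecord F θ.ν θ.τ9.M (gOfRecord₁₃ F 2 θ.toStage13Params p) p.K k => ¬ (s.Ω 1 = Set.univ ∧ s.Λ 1 = Set.univ)),
            chiSeqOfRecord F 2 θ.ν θ.τ9.M (gOfRecord₁₃ F 2 θ.toStage13Params p) p.K k s V *
              slotsOfRecord F 2 θ.ν θ.τ9 (EOfRecord₁₃ F 2 θ.toStage13Params) (wOfRecord₉ F 2 θ.toStage9Params) θ.ppSel p (gOfRecord₁₃ F 2 θ.toStage13Params p) k s V := by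
  obtain ⟨γ, hγ, hall⟩ := hB.1
  refine ⟨γ, hγ, fun p hflow hK1 hM hM₂ α₀ hα hα3 hα2 hαε hαr hε₁ hmK hε hε3 hε2 hM1 h3 hzh k hk1 hkK => ?_⟩
  have h2 : ((datumOfRecord₁₃SepCoPH F 2 θ h).C p).Sect2Form 1 := hall p hflow 1 hK1
  have hSL : SLaw₁₃CoPH F 2 θ p 1 := (sLaw₁₃CoPH_iff F 2 θ p 1).2 ((sect2Form_stage13SepCoPH_iff F 2 θ h p 1).1 h2)
  exact densOfRecord₁₃_ae_eq_sum_not_allSmallAtOne_of_sLaw_one_su2 θ p hzh hM hM₂ hK1 hα hα3 hα2 hαε hαr hε₁ hmK hε hε3 hε2 hM1 h3 hSL hk1 hkK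

end K1Face

end Summit.QuantumFields.YangMills.Theorems.BalabanUVNodesN11DensityWithoutAllSmallTerm

end
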